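import Literature.Analysis.FluidPDE.BackwardHeatPointwise
import Literature.Analysis.FluidPDE.BackwardHeatRegularity
import HarnessLib

/-!
# The local maximum estimate for the backward heat inequality (Seregin 2014, Remark A.2) — proofs

Analysis/FluidPDE proofs file (theorems only) discharging the named fact
`Literature.Analysis.FluidPDE.Carleman.seregin_backwardHeat_localMax_le_L2`
(`BackwardHeatRegularity.lean`; Seregin 2014, App. A.2, Remark A.2, p. 208): in the cylinder
`Q(R, T) = B(R) × ]0, T[`, for `u ∈ C²` satisfying `|∂ₜu + Δu| ≤ c₁(|u| + |∇u|)`,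

  `max_{Q(3R/4, 3T/4)} (|u| + √T |∇u|) ≤ c₃(c₁, R, T, n, m) (∫_{Q(R,T)} |u|²)^{1/2}`.

Seregin quotes this from the regularity theory of parabolic equations
(Ladyženskaja–Solonnikov–Ural'ceva 1968); the tree proves it for the classical functions of the
vendored statement by the potential-theoretic route

* `HeatPotentialRepresentation` — Duhamel representation of a cut-off of `u` and of its gradient
  through the Gauss–Weierstrass kernel;
* `BackwardHeatKernels`, `ParabolicCutoffProfile`, `BackwardHeatCaccioppoli` — kernel bounds,
  cut-offs, Caccioppoli's inequality;
* `BackwardHeatPointwise.pointwise_estimate` — the one-step estimate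
  `‖u(z₀)‖ + |∇u(z₀)| ≤ C ρ sup_{C⁺_ρ(z₀)} (‖u‖ + |∇u|) + C ρ^{-(d+3)} ‖u‖_{L²(C⁺_ρ(z₀))}`;

and, in this file,

* `weighted_sup_iteration` — the elementary absorption lemma: a nonnegative bounded `M` on `[a, 1)`
  with `M(θ) ≤ ½ M(θ') + A (θ' - θ)^{-N}` for `a ≤ θ < θ' < 1` satisfies
  `M(a) ≤ 4A(3N + 3)^N (1 - a)^{-N}` (Giaquinta–Giusti's iteration lemma in its simplest form);
* `localMax_le_of_future_cylinder` — **the local maximum estimate on a future cylinder**: if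
  `K = [t, t + r²] × B̄(x, r)`, `0 < r ≤ 1`, lies in the open set where `u` is `C²` and satisfies
  the inequality, then `‖u(t, x)‖ + |∇ₓu(t, x)| ≤ C r^{-(d+3)} ‖u‖_{L²(K)}` with `C = C(E, F, c₁)`
  (the pointwise estimate on the shrinking cylinders `K_θ = [t, t + (θr)²] × B̄(x, θr)` and the
  iteration applied to `M(θ) = sup_{K_θ} (‖u‖ + |∇ₓu|)`);
* `seregin_backwardHeat_localMax_le_L2_holds` — the discharge: every point of `Q(3R/4, 3T/4)`
  is the bottom centre of a future cylinder of radius `r = min(R/8, √T/4, 1)` inside `Q(R, T)`.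

## References

* G. Seregin, *Lecture notes on regularity theory for the Navier–Stokes equations*, World
  Scientific 2014, App. A.2, Remark A.2. [Seregin2014]
* O. A. Ladyženskaja, V. A. Solonnikov, N. N. Ural'ceva, *Linear and quasi-linear equations of
  parabolic type*, AMS 1968, Ch. III §§7–8.
* M. Giaquinta, *Multiple integrals in the calculus of variations and nonlinear elliptic
  systems*, Princeton 1983, Ch. V, Lemma 3.1 (the iteration lemma).
-/

noncomputable section

open MeasureTheory Set Function Filter Metric Real
open scoped Topology RealInnerProductSpace

namespace Literature.Analysis.FluidPDE

namespace Carleman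

/-! ### The absorption (iteration) lemma -/

/-- **The iteration lemma.** Let `M : ℝ → ℝ` be nonnegative and bounded by `Mtop` on `[a, 1)`,
`0 ≤ a < 1`, and suppose `M θ ≤ M θ' / 2 + A / (θ' - θ)^N` whenever `a ≤ θ < θ' < 1`.
Then `M a ≤ 4 A (3N + 3)^N / (1 - a)^N` (consider `sup_θ (1 - θ)^N M(θ)` and `θ' = θ + (1 - θ)/(3N+3)`,
where Bernoulli's inequality gives `(1 - 1/(3N+3))^N ≥ 2/3`; Giaquinta 1983, Ch. V, Lemma 3.1).
[folklore] -/
theorem weighted_sup_iteration {M : ℝ → ℝ} {A Mtop a : ℝ} {N : ℕ} (ha0 : 0 ≤ a) (ha : a < 1)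
    (hM0 : ∀ θ, a ≤ θ → θ < 1 → 0 ≤ M θ) (hMtop : ∀ θ, a ≤ θ → θ < 1 → M θ ≤ Mtop)
    (hrec : ∀ θ θ', a ≤ θ → θ < θ' → θ' < 1 → M θ ≤ M θ' / 2 + A / (θ' - θ) ^ N) :
    M a ≤ 4 * A * (3 * N + 3) ^ N / (1 - a) ^ N := by
  -- the parameter `δ = 1/(3N+3)` and Bernoulli: `(1 - δ)^N ≥ 2/3`
  set δ : ℝ := 1 / (3 * N + 3) with hδ
  have hN1 : (0 : ℝ) < 3 * N + 3 := by positivity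
  have hδ0 : 0 < δ := by rw [hδ]; positivity
  have hδ1 : δ ≤ 1 / 3 := by
    rw [hδ, div_le_div_iff₀ hN1 (by norm_num)]
    nlinarith only [Nat.cast_nonneg (α := ℝ) N]
  have hδlt1 : δ < 1 := by linarith
  have hbern : 2 / 3 ≤ (1 - δ) ^ N := by
    have h := one_add_mul_le_pow (a := -δ) (by linarith) N
    have h2 : (N : ℝ) * δ ≤ 1 / 3 := by
      rw [hδ, mul_one_div, div_le_div_iff₀ hN1 (by norm_num)]
      nlinarith only [Nat.cast_nonneg (α := ℝ) N]
    calc (2 : ℝ) / 3 ≤ 1 + N * (-δ) := by linarith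
      _ ≤ (1 + -δ) ^ N := h
      _ = (1 - δ) ^ N := by ring
  -- the weighted supremum
  set W : Set ℝ := (fun θ => (1 - θ) ^ N * M θ) '' Ico a 1 with hW
  have hWne : W.Nonempty := ⟨_, mem_image_of_mem _ ⟨le_rfl, ha⟩⟩
  have hM1 : 0 ≤ Mtop := (hM0 a le_rfl ha).trans (hMtop a le_rfl ha)
  have hWbdd : BddAbove W := by
    refine ⟨Mtop, ?_⟩
    rintro _ ⟨θ, hθ, rfl⟩
    have h1 : (1 - θ) ^ N ≤ 1 := pow_le_one₀ (by linarith [hθ.2]) (by linarith [hθ.1, ha0])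
    calc (1 - θ) ^ N * M θ ≤ 1 * Mtop :=
          mul_le_mul h1 (hMtop θ hθ.1 hθ.2) (hM0 θ hθ.1 hθ.2) zero_le_one
      _ = Mtop := one_mul _
  set Q : ℝ := sSup W with hQ
  have hleQ : ∀ θ, a ≤ θ → θ < 1 → (1 - θ) ^ N * M θ ≤ Q := fun θ h1 h2 =>
    le_csSup hWbdd (mem_image_of_mem _ ⟨h1, h2⟩)
  -- the key step
  have hkey : ∀ θ, a ≤ θ → θ < 1 → (1 - θ) ^ N * M θ ≤ (3 / 4) * Q + A / δ ^ N := by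
    intro θ h1 h2
    have h1θ : 0 < 1 - θ := by linarith
    set θ' : ℝ := θ + δ * (1 - θ) with hθ'
    have hθθ' : θ < θ' := by rw [hθ']; linarith [mul_pos hδ0 h1θ]
    have hθ'1 : θ' < 1 := by
      rw [hθ']; nlinarith only [hδlt1, h1θ]
    have e1 : 1 - θ' = (1 - δ) * (1 - θ) := by rw [hθ']; ring
    have e2 : θ' - θ = δ * (1 - θ) := by rw [hθ']; ring
    have hr := hrec θ θ' h1 hθθ' hθ'1
    have hpos : 0 < (1 - θ) ^ N := pow_pos h1θ N
    have hQ' : (1 - θ') ^ N * M θ' ≤ Q := hleQ θ' (h1.trans hθθ'.le) hθ'1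
    have hM' : 0 ≤ M θ' := hM0 θ' (h1.trans hθθ'.le) hθ'1
    -- `(1-θ)^N M θ' = (1-δ)^{-N} (1-θ')^N M θ' ≤ (3/2) Q`
    have hstep1 : (1 - θ) ^ N * M θ' ≤ (3 / 2) * Q := by
      have hd : 0 < (1 - δ) ^ N := pow_pos (by linarith) N
      have : (1 - δ) ^ N * ((1 - θ) ^ N * M θ') ≤ Q := by
        calc (1 - δ) ^ N * ((1 - θ) ^ N * M θ') = (1 - θ') ^ N * M θ' := by rw [e1, mul_pow]; ring
          _ ≤ Q := hQ'
      have hQ0 : 0 ≤ Q := le_trans (mul_nonneg (pow_nonneg (by linarith) N) (hM0 a le_rfl ha))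
        (hleQ a le_rfl ha)
      nlinarith
    -- `(1-θ)^N A/(θ'-θ)^N = A/δ^N`
    have hstep2 : (1 - θ) ^ N * (A / (θ' - θ) ^ N) = A / δ ^ N := by
      rw [e2, mul_pow]
      field_simp
    calc (1 - θ) ^ N * M θ ≤ (1 - θ) ^ N * (M θ' / 2 + A / (θ' - θ) ^ N) :=
          mul_le_mul_of_nonneg_left hr hpos.le
      _ = (1 - θ) ^ N * M θ' / 2 + (1 - θ) ^ N * (A / (θ' - θ) ^ N) := by ring
      _ ≤ (3 / 2) * Q / 2 + A / δ ^ N := by rw [hstep2]; linarith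
      _ = (3 / 4) * Q + A / δ ^ N := by ring
  -- take the supremum
  have hQle : Q ≤ (3 / 4) * Q + A / δ ^ N := by
    refine csSup_le hWne ?_
    rintro _ ⟨θ, hθ, rfl⟩
    exact hkey θ hθ.1 hθ.2
  have hQbound : Q ≤ 4 * (A / δ ^ N) := by linarith
  -- conclude at `θ = a`
  have ha1 : 0 < (1 - a) ^ N := pow_pos (by linarith) N
  have hfin : (1 - a) ^ N * M a ≤ 4 * (A / δ ^ N) := (hleQ a le_rfl ha).trans hQbound
  rw [le_div_iff₀ ha1]
  have e : 4 * (A / δ ^ N) = 4 * A * (3 * N + 3) ^ N := by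
    rw [hδ, one_div, inv_pow, div_inv_eq_mul]; ring
  calc M a * (1 - a) ^ N = (1 - a) ^ N * M a := mul_comm _ _
    _ ≤ 4 * (A / δ ^ N) := hfin
    _ = 4 * A * (3 * N + 3) ^ N := e

/-! ### The local maximum estimate on a future cylinder -/

section LocalMax

variable {E : Type*} [NormedAddCommGroup E] [InnerProductSpace ℝ E] [FiniteDimensional ℝ E]
  [MeasurableSpace E] [BorelSpace E]
variable {F : Type*} [NormedAddCommGroup F] [InnerProductSpace ℝ F]

omit [InnerProductSpace ℝ E] [FiniteDimensional ℝ E] [MeasurableSpace E] [BorelSpace E] in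
/-- A box below-and-around a cylinder inside `K = [t, t + r²] × B̄(x, r)` lies in the
`ε`-thickening of `K`: if `t ≤ s₀`, `s₀ + ρ² ≤ t + r²` and `B̄(y₀, ρ) ⊆ B̄(x, r)`, then
`[s₀ - ε, s₀ + ρ²] × B̄(y₀, ρ) ⊆ cthickening ε K`. [folklore] -/
theorem box_subset_cthickening {t r s₀ ρ ε : ℝ} {x y₀ : E} (hts : t ≤ s₀)
    (htop : s₀ + ρ ^ 2 ≤ t + r ^ 2) (hball : closedBall y₀ ρ ⊆ closedBall x r) :
    Icc (s₀ - ε) (s₀ + ρ ^ 2) ×ˢ closedBall y₀ ρ ⊆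
      cthickening ε (Icc t (t + r ^ 2) ×ˢ closedBall x r) := by
  rintro ⟨s, y⟩ ⟨hs, hy⟩
  -- the nearby point of `K`
  have hy' : y ∈ closedBall x r := hball hy
  by_cases hst : s₀ ≤ s
  · exact self_subset_cthickening _ ⟨⟨hts.trans hst, hs.2.trans htop⟩, hy'⟩
  · refine mem_cthickening_of_dist_le (s, y) (s₀, y) ε _ ⟨⟨hts, by nlinarith [sq_nonneg ρ, htop]⟩, hy'⟩ ?_
    rw [Prod.dist_eq, dist_self, max_eq_left dist_nonneg, Real.dist_eq, abs_of_nonpos (by linarith)]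
    linarith [hs.1]

/-- **The local maximum estimate on a future cylinder.** There is `C = C(E, c₁) > 0` such that:
for `u ∈ C²(U; F)` on an open `U ⊆ ℝ × E` with `‖∂ₜu + Δₓu‖ ≤ c₁ (‖u‖ + |∇ₓu|)` on `U`, and every
closed future cylinder `K = [t, t + r²] × B̄(x, r) ⊆ U` with `0 < r ≤ 1`,
`‖u(t, x)‖ + |∇ₓu(t, x)| ≤ C r^{-(d+3)} (∫_K ‖u‖²)^{1/2}`, `d = dim E`
(the pointwise estimate `pointwise_estimate` on the cylinders `K_θ = [t, t + (θr)²] × B̄(x, θr)`,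
`0 ≤ θ ≤ 1`, at scale `ρ = λ(θ' - θ)r`, and the iteration lemma `weighted_sup_iteration` for
`M(θ) = sup_{K_θ} (‖u‖ + |∇ₓu|)`; Ladyženskaja–Solonnikov–Ural'ceva 1968, Ch. III §8). [folklore] -/
theorem localMax_le_of_future_cylinder {c₁ : ℝ} (hc₁ : 0 ≤ c₁) :
    ∃ C : ℝ, 0 < C ∧ ∀ {U : Set (ℝ × E)} {u : ℝ × E → F}, IsOpen U → ContDiffOn ℝ 2 u U →
      (∀ z ∈ U, ‖dt u z + lap u z‖ ≤ c₁ * (‖u z‖ + Real.sqrt (gradSq u z))) →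
      ∀ {t : ℝ} {x : E} {r : ℝ}, 0 < r → r ≤ 1 → Icc t (t + r ^ 2) ×ˢ closedBall x r ⊆ U →
      ‖u (t, x)‖ + Real.sqrt (gradSq u (t, x)) ≤
        C / r ^ (Module.finrank ℝ E + 3) *
          Real.sqrt (∫ w in Icc t (t + r ^ 2) ×ˢ closedBall x r, ‖u w‖ ^ 2) := by
  obtain ⟨CP, hCP, hP⟩ := pointwise_estimate (E := E) (F := F) hc₁
  set N : ℕ := Module.finrank ℝ E + 3 with hN
  -- the smallness factor `λ`
  obtain ⟨lam, hlam_def⟩ : ∃ lam : ℝ, lam = min 1 (1 / (2 * CP)) := ⟨_, rfl⟩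
  have hlam0 : 0 < lam := by rw [hlam_def]; exact lt_min one_pos (by positivity)
  have hlam1 : lam ≤ 1 := by rw [hlam_def]; exact min_le_left _ _
  have hlamC : CP * lam ≤ 1 / 2 := by
    have h : lam ≤ 1 / (2 * CP) := by rw [hlam_def]; exact min_le_right _ _
    calc CP * lam ≤ CP * (1 / (2 * CP)) := mul_le_mul_of_nonneg_left h hCP.le
      _ = 1 / 2 := by field_simp
  obtain ⟨C, hC_def⟩ : ∃ C : ℝ, C = 4 * CP * (3 * N + 3) ^ N / lam ^ N + 1 := ⟨_, rfl⟩
  have hC0 : 0 < C := by rw [hC_def]; positivity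
  refine ⟨C, hC0, ?_⟩
  intro U u hU hu hineq t x r hr hr1 hKU
  -- notation
  set g : ℝ × E → ℝ := fun w => ‖u w‖ + Real.sqrt (gradSq u w) with hg
  set K : ℝ → Set (ℝ × E) := fun θ => Icc t (t + (θ * r) ^ 2) ×ˢ closedBall x (θ * r) with hK
  have hK1 : K 1 = Icc t (t + r ^ 2) ×ˢ closedBall x r := by simp [hK]
  have hKmono : ∀ θ θ', 0 ≤ θ → θ ≤ θ' → K θ ⊆ K θ' := fun θ θ' h0 hle => by
    have h1 : θ * r ≤ θ' * r := mul_le_mul_of_nonneg_right hle hr.le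
    have h2 : (θ * r) ^ 2 ≤ (θ' * r) ^ 2 := pow_le_pow_left₀ (mul_nonneg h0 hr.le) h1 2
    exact Set.prod_mono (Icc_subset_Icc le_rfl (by linarith)) (closedBall_subset_closedBall h1)
  have hKU' : ∀ θ, 0 ≤ θ → θ ≤ 1 → K θ ⊆ U := fun θ h0 h1 =>
    (hKmono θ 1 h0 h1).trans (hK1.symm ▸ hKU)
  have hKc : ∀ θ, IsCompact (K θ) := fun θ => isCompact_Icc.prod (isCompact_closedBall _ _)
  have hKne : ∀ θ, 0 ≤ θ → (t, x) ∈ K θ := fun θ h0 =>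
    ⟨⟨le_rfl, by nlinarith [sq_nonneg (θ * r)]⟩, mem_closedBall_self (by positivity)⟩
  -- continuity of `g` on `U`
  obtain ⟨cu, -, -, -⟩ := continuousOn_derivatives hU hu
  obtain ⟨-, cgsu⟩ := continuousOn_lap_gradSq hU hu
  have cg : ContinuousOn g U := cu.norm.add (Real.continuous_sqrt.comp_continuousOn cgsu)
  have hg0 : ∀ w, 0 ≤ g w := fun w => add_nonneg (norm_nonneg _) (Real.sqrt_nonneg _)
  -- the suprema
  set M : ℝ → ℝ := fun θ => sSup (g '' K θ) with hM
  have hbdd : ∀ θ, 0 ≤ θ → θ ≤ 1 → BddAbove (g '' K θ) := fun θ h0 h1 =>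
    (hKc θ).bddAbove_image (cg.mono (hKU' θ h0 h1))
  have hgle : ∀ θ, 0 ≤ θ → θ ≤ 1 → ∀ w ∈ K θ, g w ≤ M θ := fun θ h0 h1 w hw =>
    le_csSup (hbdd θ h0 h1) (mem_image_of_mem g hw)
  have hMle : ∀ θ, 0 ≤ θ → θ ≤ 1 → ∀ b, (∀ w ∈ K θ, g w ≤ b) → M θ ≤ b := fun θ h0 h1 b hb =>
    csSup_le ((nonempty_of_mem (hKne θ h0)).image g) (by rintro _ ⟨w, hw, rfl⟩; exact hb w hw)
  have hM0 : ∀ θ, 0 ≤ θ → θ ≤ 1 → 0 ≤ M θ := fun θ h0 h1 =>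
    (hg0 _).trans (hgle θ h0 h1 _ (hKne θ h0))
  have hMtop : ∀ θ, 0 ≤ θ → θ ≤ 1 → M θ ≤ M 1 := fun θ h0 h1 =>
    hMle θ h0 h1 _ fun w hw => hgle 1 zero_le_one le_rfl w (hKmono θ 1 h0 h1 hw)
  -- the collar: a thickening of `K 1` inside `U`
  obtain ⟨ε, hε, hεU⟩ := (hKc 1).exists_cthickening_subset_open hU (hKU' 1 zero_le_one le_rfl)
  rw [hK1] at hεU
  -- the `L²` norm on `K 1`
  set L : ℝ := Real.sqrt (∫ w in Icc t (t + r ^ 2) ×ˢ closedBall x r, ‖u w‖ ^ 2) with hL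
  have hL0 : 0 ≤ L := Real.sqrt_nonneg _
  have IK2 : IntegrableOn (fun w => ‖u w‖ ^ 2) (Icc t (t + r ^ 2) ×ˢ closedBall x r) volume :=
    ((cu.norm.pow 2).mono hKU).integrableOn_compact (isCompact_Icc.prod (isCompact_closedBall _ _))
  -- the recurrence
  set A : ℝ := CP * L / (lam * r) ^ N with hA
  have hrec : ∀ θ θ', 0 ≤ θ → θ < θ' → θ' < 1 → M θ ≤ M θ' / 2 + A / (θ' - θ) ^ N := by
    intro θ θ' h0 hlt h1
    have hθ'0 : 0 ≤ θ' := h0.trans hlt.le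
    set ρ : ℝ := lam * (θ' - θ) * r with hρ
    have hρ0 : 0 < ρ := by rw [hρ]; exact mul_pos (mul_pos hlam0 (by linarith)) hr
    have hρ1 : ρ ≤ 1 := by
      rw [hρ]
      calc lam * (θ' - θ) * r ≤ 1 * 1 * 1 := by
            refine mul_le_mul (mul_le_mul hlam1 (by linarith) (by linarith) zero_le_one) hr1 hr.le
              (by positivity)
        _ = 1 := by ring
    have hρle : ρ ≤ (θ' - θ) * r := by
      rw [hρ]
      calc lam * (θ' - θ) * r ≤ 1 * (θ' - θ) * r := by gcongr
        _ = (θ' - θ) * r := by ring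
    refine hMle θ h0 (hlt.le.trans h1.le) _ fun z₀ hz₀ => ?_
    -- the future cylinder of `z₀` at scale `ρ` lies in `K θ'`
    obtain ⟨⟨hs₀t, hs₀top⟩, hy₀⟩ := hz₀
    rw [mem_closedBall, dist_eq_norm] at hy₀
    have htop : z₀.1 + ρ ^ 2 ≤ t + (θ' * r) ^ 2 := by
      have h1' : (θ * r) ^ 2 + ρ ^ 2 ≤ (θ' * r) ^ 2 := by
        have : θ * r + ρ ≤ θ' * r := by nlinarith
        nlinarith [mul_nonneg h0 hr.le, hρ0.le]
      linarith
    have hball : closedBall z₀.2 ρ ⊆ closedBall x (θ' * r) := by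
      refine closedBall_subset_closedBall' ?_
      rw [dist_eq_norm]
      nlinarith
    have hCsub : Icc z₀.1 (z₀.1 + ρ ^ 2) ×ˢ closedBall z₀.2 ρ ⊆ K θ' :=
      Set.prod_mono (Icc_subset_Icc hs₀t htop) hball
    have hθ'r : θ' * r ≤ r := by nlinarith
    have hbox : Icc (z₀.1 - ε) (z₀.1 + ρ ^ 2) ×ˢ closedBall z₀.2 ρ ⊆ U := by
      refine (box_subset_cthickening hs₀t (htop.trans ?_) (hball.trans ?_)).trans hεU
      · have h2 : (θ' * r) ^ 2 ≤ r ^ 2 := pow_le_pow_left₀ (mul_nonneg hθ'0 hr.le) hθ'r 2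
        linarith
      · exact closedBall_subset_closedBall hθ'r
    -- the pointwise estimate at `z₀`
    have hS : ∀ w ∈ Icc z₀.1 (z₀.1 + ρ ^ 2) ×ˢ closedBall z₀.2 ρ, ‖u w‖ + Real.sqrt (gradSq u w) ≤ M θ' :=
      fun w hw => hgle θ' hθ'0 h1.le w (hCsub hw)
    have hPz := hP hU hu hineq hρ0 hρ1 hε hbox hS
    rw [Prod.mk.eta] at hPz
    -- the two terms
    have hT1 : CP * ρ * M θ' ≤ M θ' / 2 := by
      have : CP * ρ ≤ 1 / 2 := by
        calc CP * ρ = CP * lam * ((θ' - θ) * r) := by rw [hρ]; ring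
          _ ≤ CP * lam * 1 := by
              refine mul_le_mul_of_nonneg_left ?_ (by positivity)
              calc (θ' - θ) * r ≤ 1 * 1 := mul_le_mul (by linarith) hr1 hr.le zero_le_one
                _ = 1 := one_mul _
          _ ≤ 1 / 2 := by linarith
      have hM' := hM0 θ' hθ'0 h1.le
      nlinarith
    have hT2 : CP / ρ ^ N * Real.sqrt (∫ w in Icc z₀.1 (z₀.1 + ρ ^ 2) ×ˢ closedBall z₀.2 ρ, ‖u w‖ ^ 2) ≤
        A / (θ' - θ) ^ N := by
      have hK1sub : K θ' ⊆ Icc t (t + r ^ 2) ×ˢ closedBall x r := by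
        rw [← hK1]; exact hKmono θ' 1 hθ'0 h1.le
      have hint : Real.sqrt (∫ w in Icc z₀.1 (z₀.1 + ρ ^ 2) ×ˢ closedBall z₀.2 ρ, ‖u w‖ ^ 2) ≤ L := by
        rw [hL]
        exact Real.sqrt_le_sqrt (setIntegral_mono_set IK2 (Eventually.of_forall fun w => sq_nonneg _)
          (Eventually.of_forall (hCsub.trans hK1sub)))
      have e : A / (θ' - θ) ^ N = CP / ρ ^ N * L := by
        rw [hA, hρ, mul_pow, mul_pow, mul_pow]
        field_simp
      rw [e]
      exact mul_le_mul_of_nonneg_left hint (by positivity)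
    show g z₀ ≤ M θ' / 2 + A / (θ' - θ) ^ N
    calc g z₀ ≤ CP * ρ * M θ' + CP / ρ ^ (Module.finrank ℝ E + 3) *
          Real.sqrt (∫ w in Icc z₀.1 (z₀.1 + ρ ^ 2) ×ˢ closedBall z₀.2 ρ, ‖u w‖ ^ 2) := hPz
      _ ≤ M θ' / 2 + A / (θ' - θ) ^ N := add_le_add hT1 hT2
  -- iterate
  have hiter := weighted_sup_iteration (M := M) (a := 0) le_rfl zero_lt_one
    (fun θ h0 h1 => hM0 θ h0 h1.le) (fun θ h0 h1 => hMtop θ h0 h1.le) hrec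
  rw [sub_zero, one_pow, div_one] at hiter
  -- conclude at the base point
  have hbase : g (t, x) ≤ M 0 := hgle 0 le_rfl zero_le_one _ (hKne 0 le_rfl)
  have e : 4 * A * (3 * N + 3) ^ N = (4 * CP * (3 * N + 3) ^ N / lam ^ N) / r ^ N * L := by
    rw [hA, mul_pow]
    field_simp
  have hfinal : g (t, x) ≤ (4 * CP * (3 * N + 3) ^ N / lam ^ N) / r ^ N * L := by
    rw [← e]; exact hbase.trans hiter
  refine hfinal.trans ?_
  have hrN : 0 < r ^ N := pow_pos hr N
  have : (4 * CP * (3 * N + 3) ^ N / lam ^ N) / r ^ N ≤ C / r ^ N :=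
    div_le_div_of_nonneg_right (by rw [hC_def]; linarith) hrN.le
  exact mul_le_mul_of_nonneg_right this hL0

end LocalMax

/-! ### The discharge of Seregin's Remark A.2 -/

/-- **Seregin 2014, Remark A.2, proved** (discharge of the named fact
`seregin_backwardHeat_localMax_le_L2`): for `u ∈ C²(Q(R, T); ℝᵐ)` with
`|∂ₜu + Δu| ≤ c₁(|u| + |∇u|)` and the (A.2.1) integrability, every point `(t, x)` with
`0 < t < 3T/4`, `|x| < 3R/4` satisfies
`|u(x, t)| + √T |∇u(x, t)| ≤ c₃(c₁, R, T, n, m) (∫_{Q(R,T)} |u|²)^{1/2}`: the future cylinder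
`[t, t + r²] × B̄(x, r)`, `r = min(R/8, √T/4, 1)`, lies in `Q(R, T)`, and
`localMax_le_of_future_cylinder` applies. [cite: Seregin2014, App. A.2 Remark A.2] -/
theorem seregin_backwardHeat_localMax_le_L2_holds : seregin_backwardHeat_localMax_le_L2 := by
  intro n m c₁ R T hR hT
  obtain ⟨C, hC, hloc⟩ := localMax_le_of_future_cylinder (E := EuclideanSpace ℝ (Fin n))
    (F := EuclideanSpace ℝ (Fin m)) (c₁ := max c₁ 0) (le_max_right _ _)
  -- the radius of the future cylinders
  set r : ℝ := min (R / 8) (min (Real.sqrt T / 4) 1) with hr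
  have hr0 : 0 < r := lt_min (by positivity) (lt_min (by positivity) one_pos)
  have hr1 : r ≤ 1 := (min_le_right _ _).trans (min_le_right _ _)
  have hrR : r ≤ R / 8 := min_le_left _ _
  have hrT : r ^ 2 ≤ T / 16 := by
    have h : r ≤ Real.sqrt T / 4 := (min_le_right _ _).trans (min_le_left _ _)
    have h2 : r ^ 2 ≤ (Real.sqrt T / 4) ^ 2 := pow_le_pow_left₀ hr0.le h 2
    rw [div_pow, Real.sq_sqrt hT.le] at h2
    linarith
  set N : ℕ := Module.finrank ℝ (EuclideanSpace ℝ (Fin n)) + 3 with hN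
  refine ⟨max 1 (Real.sqrt T) * C / r ^ N, by positivity, ?_⟩
  intro u hu hL2 _ _ _ hineq z hz
  set U : Set (ℝ × EuclideanSpace ℝ (Fin n)) := Ioo (0 : ℝ) T ×ˢ ball (0 : EuclideanSpace ℝ (Fin n)) R with hU
  have hUo : IsOpen U := isOpen_Ioo.prod isOpen_ball
  -- the inequality with the nonnegative constant `max c₁ 0`
  have hineq' : ∀ w ∈ U, ‖dt u w + lap u w‖ ≤ max c₁ 0 * (‖u w‖ + Real.sqrt (gradSq u w)) :=
    fun w hw => (hineq w hw).trans (mul_le_mul_of_nonneg_right (le_max_left _ _)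
      (add_nonneg (norm_nonneg _) (Real.sqrt_nonneg _)))
  -- the future cylinder of `z` lies in `Q(R, T)`
  obtain ⟨⟨hz1, hz2⟩, hz3⟩ := hz
  rw [mem_ball, dist_zero_right] at hz3
  have hK : Icc z.1 (z.1 + r ^ 2) ×ˢ closedBall z.2 r ⊆ U := by
    rintro ⟨s, y⟩ ⟨⟨hs1, hs2⟩, hy⟩
    refine ⟨⟨by linarith, by linarith⟩, ?_⟩
    rw [mem_ball, dist_zero_right]
    rw [mem_closedBall, dist_eq_norm] at hy
    calc ‖y‖ = ‖(y - z.2) + z.2‖ := by rw [sub_add_cancel]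
      _ ≤ ‖y - z.2‖ + ‖z.2‖ := norm_add_le _ _
      _ < R := by linarith
  have h := hloc hUo hu hineq' hr0 hr1 hK
  rw [Prod.mk.eta] at h
  -- compare the `L²` norms
  have hmono : ∫ w in Icc z.1 (z.1 + r ^ 2) ×ˢ closedBall z.2 r, ‖u w‖ ^ 2 ≤ ∫ w in U, ‖u w‖ ^ 2 :=
    setIntegral_mono_set hL2 (Eventually.of_forall fun w => sq_nonneg _) (Eventually.of_forall hK)
  have hsqrt := Real.sqrt_le_sqrt hmono
  have hmax0 : 0 ≤ max 1 (Real.sqrt T) := le_trans zero_le_one (le_max_left _ _)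
  have hrN : 0 < r ^ N := pow_pos hr0 N
  calc ‖u z‖ + Real.sqrt T * Real.sqrt (gradSq u z)
      ≤ max 1 (Real.sqrt T) * (‖u z‖ + Real.sqrt (gradSq u z)) := by
        rw [mul_add]
        exact add_le_add (le_mul_of_one_le_left (norm_nonneg _) (le_max_left _ _))
          (mul_le_mul_of_nonneg_right (le_max_right _ _) (Real.sqrt_nonneg _))
    _ ≤ max 1 (Real.sqrt T) * (C / r ^ N *
        Real.sqrt (∫ w in Icc z.1 (z.1 + r ^ 2) ×ˢ closedBall z.2 r, ‖u w‖ ^ 2)) :=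
        mul_le_mul_of_nonneg_left h hmax0
    _ ≤ max 1 (Real.sqrt T) * (C / r ^ N * Real.sqrt (∫ w in U, ‖u w‖ ^ 2)) := by
        gcongr
    _ = max 1 (Real.sqrt T) * C / r ^ N * Real.sqrt (∫ w in U, ‖u w‖ ^ 2) := by ring

end Carleman

end Literature.Analysis.FluidPDE
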